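import Summits.BirchSwinnertonDyer.BirchSwinnertonDyer.Theorems.TeichmullerTwistDescentCarrierDefs
import Summits.BirchSwinnertonDyer.Rank1Residual.Additive.MinimalGoodReductionField
import Summits.BirchSwinnertonDyer.Rank1Residual.Additive.GordKodairaType
import Summits.BirchSwinnertonDyer.Rank1Residual.Additive.TypeGRamification
import Summits.BirchSwinnertonDyer.Rank1Residual.Additive.TypeGIntegralJ
import HarnessLib

/-!
# Route `TeichmullerTwistDescent`, crux K `TwistedPeriodLatticeSaturation` (stmt-BirchSwinnertonDyer-25368):
# the ARITHMETIC OF THE PREFIX of the K-line inputs — `p ≥ 13`, `e ∈ {3, 4, 6}`, `e ∣ p − 1`, `e·ord_pΔ = 12`,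
# `e·b = p − 1`, `0 < b`, `2b < p − 1` for the tame exponent `b = tameExponent p W`

Cell `pub/bsd-wall` (D-0145 line route-BirchSwinnertonDyer-TeichmullerTwistDescent, OPEN rev 7), seat `bsd-line-ttd-p1`
(prover 1/2, g26).  THEOREMS ONLY (no definition, no named fact, no `sorry`, no instance, no notation).  BSD is not proved
by this file; K is not proved by this file; nothing here closes an item.

Every remaining input of the K-line — (I1‴) `NonzeroBorelEigenfunctional`, (I1⁗) `TwistedBorelPeriodSumNonvanishing`,
(W‴) `NoEtaleWeightEigenQuotient` (files `TeichmullerTwistDescentCarrierDefs`, `TeichmullerTwistDescentMackeyDefs`) — opens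
with the same prefix

  `11 ≤ p`, `Rank1Residual.Addv W p`, `Rank1Residual.Additive.TypeGOrd W p`, `padicValInt p W.minimalDiscriminantInt ≤ 4`

for a globally minimal `W`, and (I1‴)/(I1⁗) begin their conclusion with `0 < tameExponent p W ∧ 2 * tameExponent p W < p - 1`.
This file discharges that conjunct ONCE AND FOR ALL and records the arithmetic every typer / prover of those inputs needs,
from the cell `b2b-bsdres` API on the semistability defect `e = semistabilityIndex W p = 12 / gcd(12, ord_pΔ_min)`:

* `padicValInt_mem` — additive and `ord_pΔ_min ≤ 4` at `p ≥ 5` ⟹ `ord_pΔ_min ∈ {2, 3, 4}` (Kodaira II / III / IV;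
  `kodairaSymbolAt_placeOf_cases_of_addv`);
* `semistabilityIndex_mul_padicValInt` — then `e · ord_pΔ_min = 12` (`e = 6, 4, 3`), `semistabilityIndex_mem` — `e ∈ {3, 4, 6}`;
* `semistabilityIndex_dvd_sub_one` — (G)-ordinary ⟹ `e ∣ p − 1` (`typeG_iff_not_subM_and_semistabilityIndex_dvd`);
* `thirteen_le` — hence `p ≠ 11` under the prefix (`3, 4, 6 ∤ 10`): **at `p = 11` the prefix is contradictory**, so
  (I1‴)/(I1⁗)/(W‴) hold vacuously there (`prefix_false_eleven`), and `p ≥ 13` otherwise — the caveat of the g25 memo §10 made a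
  theorem;
* `semistabilityIndex_mul_tameExponent` — `e · tameExponent p W = p − 1`, i.e. `b = (p − 1)/e` EXACTLY;
* `tameExponent_pos`, `two_mul_tameExponent_lt` — `0 < b` and `2b < p − 1` (as `e ≥ 3`);
* `tameExponent_bounds` — the conjunct `0 < tameExponent p W ∧ 2 * tameExponent p W < p - 1` under the literal prefix.

## References
* J.-P. Serre, *Propriétés galoisiennes des points d'ordre fini des courbes elliptiques*, Invent. Math. 15 (1972) §5.6
  (the inertia image at a potentially good `p ≥ 5` is cyclic of order `e = 12/gcd(12, v(Δ))`; potentially ORDINARY ⟹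
  `e ∣ p − 1`). [Serre1972]
* J. H. Silverman, *Advanced Topics in the Arithmetic of Elliptic Curves*, GTM 151 (1994), IV Table 4.1 (Kodaira symbols
  and `ord_pΔ_min`). [SilvermanATAEC1994]
* B. Edixhoven, *On the Manin constants of modular elliptic curves*, in: Arithmetic Algebraic Geometry (Texel 1989),
  Progr. Math. 89 (1991), §4 (the potentially ordinary II/III/IV case). [EdixhovenManin1991]
-/

set_option linter.dupNamespace false

noncomputable section

namespace Summit.BirchSwinnertonDyer.BirchSwinnertonDyer.Theorems.TeichmullerTwistDescent.TameExponent

open WeierstrassCurve Literature.NumberTheory.EllipticCurves Literature.NumberTheory.EllipticCurves.Rank1Residual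
open Summit.BirchSwinnertonDyer.Rank1Residual.Additive
open Summit.BirchSwinnertonDyer.BirchSwinnertonDyer.Theorems.TeichmullerTwistDescent (tameExponent)

variable (W : WeierstrassCurve ℚ) [W.IsElliptic] [W.IsGloballyMinimal] (p : ℕ) [hp : Fact p.Prime]

/-! ### `ord_pΔ_min ∈ {2, 3, 4}` and `e ∈ {3, 4, 6}` on the unstarred additive types -/

/-- **Additive with `ord_pΔ_min ≤ 4` at `p ≥ 5` ⟹ `ord_pΔ_min ∈ {2, 3, 4}`** (Kodaira II, III, IV: the additive symbols have
`ord_pΔ_min ∈ {2, 3, 4} ∪ {6 + n, 8, 9, 10}`). [cite: SilvermanATAEC1994, IV Table 4.1] -/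
theorem padicValInt_mem (hp5 : 5 ≤ p) (hadd : Addv W p) (hv : padicValInt p W.minimalDiscriminantInt ≤ 4) :
    padicValInt p W.minimalDiscriminantInt = 2 ∨ padicValInt p W.minimalDiscriminantInt = 3 ∨
      padicValInt p W.minimalDiscriminantInt = 4 := by
  rcases kodairaSymbolAt_placeOf_cases_of_addv W p hp5 hadd with
    ⟨-, h⟩ | ⟨-, h⟩ | ⟨-, h⟩ | ⟨n, -, h⟩ | ⟨-, h⟩ | ⟨-, h⟩ | ⟨-, h⟩ <;> omega

/-- **`e · ord_pΔ_min = 12`** on the unstarred additive types at `p ≥ 5` (`(e, ord_pΔ_min) ∈ {(6,2), (4,3), (3,4)}`).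
[cite: Serre1972, §5.6] [cite: SilvermanATAEC1994, IV Table 4.1] -/
theorem semistabilityIndex_mul_padicValInt (hp5 : 5 ≤ p) (hadd : Addv W p)
    (hv : padicValInt p W.minimalDiscriminantInt ≤ 4) :
    semistabilityIndex W p * padicValInt p W.minimalDiscriminantInt = 12 := by
  unfold semistabilityIndex
  rcases padicValInt_mem W p hp5 hadd hv with h | h | h <;> rw [h] <;> decide

/-- **`e ∈ {3, 4, 6}`** on the unstarred additive types at `p ≥ 5`: `e = 6` on II, `4` on III, `3` on IV.
[cite: Serre1972, §5.6] [cite: SilvermanATAEC1994, IV Table 4.1] -/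
theorem semistabilityIndex_mem (hp5 : 5 ≤ p) (hadd : Addv W p) (hv : padicValInt p W.minimalDiscriminantInt ≤ 4) :
    semistabilityIndex W p = 3 ∨ semistabilityIndex W p = 4 ∨ semistabilityIndex W p = 6 := by
  unfold semistabilityIndex
  rcases padicValInt_mem W p hp5 hadd hv with h | h | h <;> rw [h] <;> decide

/-- The dictionary `e = 6 ↔ ord_pΔ_min = 2`, `e = 4 ↔ 3`, `e = 3 ↔ 4` on the unstarred additive types at `p ≥ 5`, as the
three admissible pairs. [cite: SilvermanATAEC1994, IV Table 4.1] -/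
theorem semistabilityIndex_and_padicValInt_cases (hp5 : 5 ≤ p) (hadd : Addv W p)
    (hv : padicValInt p W.minimalDiscriminantInt ≤ 4) :
    (semistabilityIndex W p = 6 ∧ padicValInt p W.minimalDiscriminantInt = 2) ∨
      (semistabilityIndex W p = 4 ∧ padicValInt p W.minimalDiscriminantInt = 3) ∨
        (semistabilityIndex W p = 3 ∧ padicValInt p W.minimalDiscriminantInt = 4) := by
  unfold semistabilityIndex
  rcases padicValInt_mem W p hp5 hadd hv with h | h | h <;> rw [h] <;> decide

/-! ### (G)-ordinary ⟹ `e ∣ p − 1`; the prefix forces `p ≥ 13` -/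

/-- **(G)-ordinary ⟹ `e ∣ p − 1`** (`p ≥ 5`): good reduction over a subfield of `ℚ(ζ_p)` of degree `d ∣ p − 1` forces
`e ∣ d` (cell theorem `typeG_iff_not_subM_and_semistabilityIndex_dvd`). [cite: Serre1972, §5.6] -/
theorem semistabilityIndex_dvd_sub_one (hp5 : 5 ≤ p) (hG : TypeGOrd W p) : semistabilityIndex W p ∣ p - 1 :=
  ((typeG_iff_not_subM_and_semistabilityIndex_dvd W p hp5).mp hG.typeG).2

/-- **The prefix forces `p ≥ 13`**: `11 ≤ p`, additive, (G)-ordinary, `ord_pΔ_min ≤ 4` ⟹ `e ∈ {3, 4, 6}` divides `p − 1`,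
impossible at `p = 11` (`3, 4, 6 ∤ 10`) and `p = 12` is not prime. [cite: Serre1972, §5.6] [cite: EdixhovenManin1991, §4] -/
theorem thirteen_le (hp11 : 11 ≤ p) (hadd : Addv W p) (hG : TypeGOrd W p)
    (hv : padicValInt p W.minimalDiscriminantInt ≤ 4) : 13 ≤ p := by
  have hp5 : 5 ≤ p := le_trans (by norm_num) hp11
  have hdvd := semistabilityIndex_dvd_sub_one W p hp5 hG
  have hmem := semistabilityIndex_mem W p hp5 hadd hv
  by_contra hlt
  have hp' : p = 11 ∨ p = 12 := by omega
  rcases hp' with rfl | rfl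
  · rcases hmem with h | h | h <;> rw [h] at hdvd <;> revert hdvd <;> decide
  · exact absurd hp.out (by decide)

/-- **At `p = 11` the prefix is contradictory** (so (I1‴), (I1⁗), (W‴) hold vacuously there): no additive (G)-ordinary
curve with `ord₁₁Δ_min ≤ 4` exists, since `e ∈ {3, 4, 6} ∤ 10`. [cite: Serre1972, §5.6] [cite: EdixhovenManin1991, §4] -/
theorem prefix_false_eleven [Fact (Nat.Prime 11)] (W : WeierstrassCurve ℚ) [W.IsElliptic] [W.IsGloballyMinimal]
    (hadd : Addv W 11) (hG : TypeGOrd W 11) (hv : padicValInt 11 W.minimalDiscriminantInt ≤ 4) : False := by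
  have h := thirteen_le W 11 le_rfl hadd hG hv
  omega

/-! ### The tame exponent: `e · b = p − 1`, `0 < b`, `2b < p − 1` -/

/-- **`e · tameExponent p W = p − 1`** under the prefix at `p ≥ 5`: `b = (p − 1)·ord_pΔ_min/12 = (p − 1)/e` exactly
(`e·ord_pΔ_min = 12`, `e ∣ p − 1`). [cite: Serre1972, §5.6] [cite: EdixhovenManin1991, §4] -/
theorem semistabilityIndex_mul_tameExponent (hp5 : 5 ≤ p) (hadd : Addv W p) (hG : TypeGOrd W p)
    (hv : padicValInt p W.minimalDiscriminantInt ≤ 4) :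
    semistabilityIndex W p * tameExponent p W = p - 1 := by
  obtain ⟨d, hd⟩ := semistabilityIndex_dvd_sub_one W p hp5 hG
  have h12 := semistabilityIndex_mul_padicValInt W p hp5 hadd hv
  unfold tameExponent
  rw [hd]
  -- `(e d) v / 12 = d (e v) / 12 = 12 d / 12 = d`
  have : semistabilityIndex W p * d * padicValInt p W.minimalDiscriminantInt / 12 = d := by
    rw [mul_right_comm, h12]
    omega
  rw [this]

/-- **`0 < tameExponent p W`** under the prefix at `p ≥ 5`. [cite: EdixhovenManin1991, §4] -/
theorem tameExponent_pos (hp5 : 5 ≤ p) (hadd : Addv W p) (hG : TypeGOrd W p)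
    (hv : padicValInt p W.minimalDiscriminantInt ≤ 4) : 0 < tameExponent p W := by
  have h := semistabilityIndex_mul_tameExponent W p hp5 hadd hG hv
  rcases Nat.eq_zero_or_pos (tameExponent p W) with h0 | h0
  · rw [h0, mul_zero] at h
    omega
  · exact h0

/-- **`2 · tameExponent p W < p − 1`** under the prefix at `p ≥ 5` (as `e ≥ 3`: `2b < e b = p − 1`).
[cite: EdixhovenManin1991, §4] -/
theorem two_mul_tameExponent_lt (hp5 : 5 ≤ p) (hadd : Addv W p) (hG : TypeGOrd W p)
    (hv : padicValInt p W.minimalDiscriminantInt ≤ 4) : 2 * tameExponent p W < p - 1 := by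
  have h := semistabilityIndex_mul_tameExponent W p hp5 hadd hG hv
  have hpos := tameExponent_pos W p hp5 hadd hG hv
  have h3 : 3 ≤ semistabilityIndex W p := by
    rcases semistabilityIndex_mem W p hp5 hadd hv with h' | h' | h' <;> omega
  calc 2 * tameExponent p W < 3 * tameExponent p W := by omega
    _ ≤ semistabilityIndex W p * tameExponent p W := Nat.mul_le_mul_right _ h3
    _ = p - 1 := h

/-- **`tameExponent p W ≤ (p − 1)/3`** under the prefix at `p ≥ 5` (`e ≥ 3`). [cite: EdixhovenManin1991, §4] -/
theorem three_mul_tameExponent_le (hp5 : 5 ≤ p) (hadd : Addv W p) (hG : TypeGOrd W p)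
    (hv : padicValInt p W.minimalDiscriminantInt ≤ 4) : 3 * tameExponent p W ≤ p - 1 := by
  have h := semistabilityIndex_mul_tameExponent W p hp5 hadd hG hv
  have h3 : 3 ≤ semistabilityIndex W p := by
    rcases semistabilityIndex_mem W p hp5 hadd hv with h' | h' | h' <;> omega
  calc 3 * tameExponent p W ≤ semistabilityIndex W p * tameExponent p W := Nat.mul_le_mul_right _ h3
    _ = p - 1 := h

/-- **`2 ≤ tameExponent p W`** under the literal prefix (`11 ≤ p`, hence `p ≥ 13` and `b = (p − 1)/e ≥ 12/6`).
[cite: EdixhovenManin1991, §4] -/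
theorem two_le_tameExponent (hp11 : 11 ≤ p) (hadd : Addv W p) (hG : TypeGOrd W p)
    (hv : padicValInt p W.minimalDiscriminantInt ≤ 4) : 2 ≤ tameExponent p W := by
  have hp5 : 5 ≤ p := le_trans (by norm_num) hp11
  have h13 := thirteen_le W p hp11 hadd hG hv
  have h := semistabilityIndex_mul_tameExponent W p hp5 hadd hG hv
  have h6 : semistabilityIndex W p ≤ 6 := by
    rcases semistabilityIndex_mem W p hp5 hadd hv with h' | h' | h' <;> omega
  by_contra hlt
  have hb : tameExponent p W ≤ 1 := by omega
  have : semistabilityIndex W p * tameExponent p W ≤ 6 * 1 := Nat.mul_le_mul h6 hb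
  omega

/-- **The explicit values**: `(e, ord_pΔ_min, b) ∈ {(6, 2, (p−1)/6), (4, 3, (p−1)/4), (3, 4, (p−1)/3)}` under the prefix
at `p ≥ 5`, each with `e ∣ p − 1`. [cite: Serre1972, §5.6] [cite: EdixhovenManin1991, §4] -/
theorem tameExponent_cases (hp5 : 5 ≤ p) (hadd : Addv W p) (hG : TypeGOrd W p)
    (hv : padicValInt p W.minimalDiscriminantInt ≤ 4) :
    (padicValInt p W.minimalDiscriminantInt = 2 ∧ 6 ∣ p - 1 ∧ 6 * tameExponent p W = p - 1) ∨
      (padicValInt p W.minimalDiscriminantInt = 3 ∧ 4 ∣ p - 1 ∧ 4 * tameExponent p W = p - 1) ∨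
        (padicValInt p W.minimalDiscriminantInt = 4 ∧ 3 ∣ p - 1 ∧ 3 * tameExponent p W = p - 1) := by
  have hdvd := semistabilityIndex_dvd_sub_one W p hp5 hG
  have hmul := semistabilityIndex_mul_tameExponent W p hp5 hadd hG hv
  rcases semistabilityIndex_and_padicValInt_cases W p hp5 hadd hv with ⟨he, h⟩ | ⟨he, h⟩ | ⟨he, h⟩ <;>
    rw [he] at hdvd hmul
  · exact Or.inl ⟨h, hdvd, hmul⟩
  · exact Or.inr (Or.inl ⟨h, hdvd, hmul⟩)
  · exact Or.inr (Or.inr ⟨h, hdvd, hmul⟩)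

/-- **The first conjunct of (I1‴) / (I1⁗) under their literal prefix**: `11 ≤ p`, additive, (G)-ordinary,
`ord_pΔ_min ≤ 4` ⟹ `0 < tameExponent p W ∧ 2 * tameExponent p W < p - 1`.  (The instance and datum binders of those
statements are not needed.) [cite: EdixhovenManin1991, §4] -/
theorem tameExponent_bounds (hp11 : 11 ≤ p) (hadd : Addv W p) (hG : TypeGOrd W p)
    (hv : padicValInt p W.minimalDiscriminantInt ≤ 4) :
    0 < tameExponent p W ∧ 2 * tameExponent p W < p - 1 :=
  have hp5 : 5 ≤ p := le_trans (by norm_num) hp11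
  ⟨tameExponent_pos W p hp5 hadd hG hv, two_mul_tameExponent_lt W p hp5 hadd hG hv⟩

/-- **Summary under the literal prefix**: `13 ≤ p`, `e ∈ {3,4,6}`, `e ∣ p − 1`, `e · ord_pΔ_min = 12`, `e · b = p − 1`,
`0 < b`, `2b < p − 1` (`b = tameExponent p W`, `e = semistabilityIndex W p`). [cite: Serre1972, §5.6] [cite: EdixhovenManin1991, §4] -/
theorem prefix_arith (hp11 : 11 ≤ p) (hadd : Addv W p) (hG : TypeGOrd W p)
    (hv : padicValInt p W.minimalDiscriminantInt ≤ 4) :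
    13 ≤ p ∧
      (semistabilityIndex W p = 3 ∨ semistabilityIndex W p = 4 ∨ semistabilityIndex W p = 6) ∧
      semistabilityIndex W p ∣ p - 1 ∧
      semistabilityIndex W p * padicValInt p W.minimalDiscriminantInt = 12 ∧
      semistabilityIndex W p * tameExponent p W = p - 1 ∧
      0 < tameExponent p W ∧ 2 * tameExponent p W < p - 1 :=
  have hp5 : 5 ≤ p := le_trans (by norm_num) hp11
  ⟨thirteen_le W p hp11 hadd hG hv, semistabilityIndex_mem W p hp5 hadd hv, semistabilityIndex_dvd_sub_one W p hp5 hG,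
    semistabilityIndex_mul_padicValInt W p hp5 hadd hv, semistabilityIndex_mul_tameExponent W p hp5 hadd hG hv,
    tameExponent_pos W p hp5 hadd hG hv, two_mul_tameExponent_lt W p hp5 hadd hG hv⟩

end Summit.BirchSwinnertonDyer.BirchSwinnertonDyer.Theorems.TeichmullerTwistDescent.TameExponent
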